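import Summits.Schanuel.Schanuel.Theorems.ZilberEacBranchPoleFibreLogTerm
import Summits.Schanuel.Schanuel.Theorems.ZilberEacSuperellipticSheets
import Summits.Schanuel.Schanuel.Theorems.ZilberEacSuperellipticResidueClass
import HarnessLib

/-!
# Arbitrary base branches, XXXVI: the coordinate fibres `y₀ = x₁`, `y₀ = x₀` over EVERY
# hyperelliptic / superelliptic curve `x₁^k = P(x₀)` with `deg P > k` — no residue class

HONEST FRAMING.  Cell `pub-schanuel` (Zilber's Exponential-Algebraic Closedness, case ladder;
host summit Schanuel), seat 2, gen 29.  Files XXXIII (principal sheet, off the residue class) and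
XXXIV (non-principal sheets, `k ≥ 3`) left the coordinate fibres over the hyperelliptic curves
`x₁² = P(x₀)` of degree `M ≡ 2 (mod 4)` (both sheets real, top phase coefficient imaginary).  The
sheets of `x₁^k = P(x₀)` are FLAT to order `k` — `Φ(s) = ζ(1 + p_{M−1}s^k + ⋯)^{1/k}`, so
`‖Φ(s) − ζ‖ = O(‖s‖^k)` (**`superelliptic_sheet_facts_flat`**) — hence file XXXV's logarithmic term
applies: **`unprojectedDense_branch_poleFibre_of_flat`** (flat branch, `1 ≤ k < M`, pole/zero
fibre: dense, NO direction hypothesis), and therefore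
**`unprojectedDensityQuestion_superelliptic_coordFibres`**: for ALL `k ≥ 2` and ALL monic `P` of
degree `M > k` with a simple root, `{x₁^k − P(x₀) = 0, y₀ = x₁}` and `{…, y₀ = x₀}` are in
Mantova–Masser's case AND dense; in particular
(**`unprojectedDensityQuestion_hyperelliptic_coordFibres`**) over EVERY hyperelliptic curve
`x₁² = P(x₀)` of degree `≥ 3`, every genus.  Together with files XXXIII–XXXIV the coordinate fibres
over `x₁^k = P(x₀)` are decided for every `(k, deg P)` with `k ≥ 2` except the conics `k = deg P = 2`
(asymptotes of rational slope `±1`; OPEN).  Decided instances of an OPEN question (Mantova–Masser,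
PLMS 2024 §1 p. 5); EC(3,2) OPEN; NOT Schanuel's conjecture (neither used nor implied); EAC ⇏ SC.
-/

noncomputable section

open Filter Topology Set Complex MvPolynomial Asymptotics
open Literature.NumberTheory.Transcendental Literature.ModelTheory.Zilber
open Literature.ModelTheory.ExponentialFields

set_option linter.dupNamespace false

namespace Summit.Schanuel.Schanuel.Theorems

/-! ## Part A. Flat branches: no direction condition for pole / zero fibres -/

/-- **Pole / zero fibres over a flat branch: no direction condition** (`1 ≤ k < M`, `L ≠ 0`,
`‖Φ − Φ(0)‖ = O(‖s‖^k)`): dense — in a good direction by file XXXII, in a bad one by the logarithmic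
term of file XXXV. [cite: MantovaMasser2023, §1 Further remarks, p. 5 (the question, open in
general)] (new) -/
theorem unprojectedDense_branch_poleFibre_of_flat {S : Set (Fin 2 ⊕ Fin 2 → ℂ)}
    (hS : IsIrreducibleClosed ℂ S) (hdim : zariskiDim ℂ S ≤ (2 : ℕ))
    {k M : ℕ} (hk : 1 ≤ k) (hkM : k < M) {L : ℤ} (hL : L ≠ 0) {ψ : ℂ → ℂ} (hψ : AnalyticAt ℂ ψ 0)
    (hψ0 : ψ 0 ≠ 0) {Φ : ℂ → ℂ} (hΦ : AnalyticAt ℂ Φ 0) (hΦ0 : Φ 0 ≠ 0)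
    (hΦk : ∃ K : ℝ, ∀ᶠ s in 𝓝 (0 : ℂ), ‖Φ s - Φ 0‖ ≤ K * ‖s‖ ^ k)
    (hgerm : ∀ᶠ s in 𝓝[≠] (0 : ℂ),
      (Sum.elim ![(s ^ k)⁻¹, Φ s * (s ^ M)⁻¹] ![ψ s * s ^ L, Complex.exp (Φ s * (s ^ M)⁻¹)] :
        Fin 2 ⊕ Fin 2 → ℂ) ∈ S) :
    UnprojectedDense S := by
  obtain ⟨z, hz⟩ := IsAlgClosed.exists_pow_nat_eq (2 * Real.pi * I : ℂ) (by omega : 0 < k)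
  by_cases hzre : (Φ 0 * z ^ M).re = 0
  · exact unprojectedDense_branch_poleFibre_logTerm hS hdim hk hkM hL hψ hψ0 hΦ hΦ0 hΦk hz hzre hgerm
  · exact unprojectedDense_branch_poleFibre_of_exists_direction hS hdim hk (by omega) L hψ hψ0 hΦ
      ⟨z, hz, hzre⟩ hgerm

section Superelliptic

variable (P : Polynomial ℂ)

/-- **The sheets of `x₁^k = P(x₀)` are flat to order `k`**: for `ζ^k = 1` and `P` monic of degree
`M ≥ 1`, the sheet `x₁ = Φ(s)s^{-M}` of file XXXIV (`Φ(0) = ζ`, `(Φ(s)s^{-M})^k = P(s^{-k})`) may be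
chosen with `‖Φ(s) − ζ‖ ≤ K‖s‖^k` near `0` (indeed `Φ = ζ(1 + (P(s^{-k})s^{kM} − 1))^{1/k}` and
`(P(s^{-k})s^{kM} − 1)/s^k → p_{M−1}`). [folklore] -/
theorem superelliptic_sheet_facts_flat {k : ℕ} (hk : 1 ≤ k) (hP : P.Monic) (hM : 1 ≤ P.natDegree)
    {ζ : ℂ} (hζ : ζ ^ k = 1) :
    ∃ Φ : ℂ → ℂ, AnalyticAt ℂ Φ 0 ∧ Φ 0 = ζ ∧
      (∃ K : ℝ, ∀ᶠ s in 𝓝 (0 : ℂ), ‖Φ s - Φ 0‖ ≤ K * ‖s‖ ^ k) ∧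
      ∀ᶠ s in 𝓝[≠] (0 : ℂ), (Φ s * (s ^ P.natDegree)⁻¹) ^ k - P.eval (s ^ k)⁻¹ = 0 := by
  set M := P.natDegree with hMdef
  obtain ⟨q, hqan, hq0, hqk⟩ := kthRoot_branch_facts hk
  obtain ⟨U₀, hUan, hU0, hUeval⟩ :=
    exists_polarForm_eval P (U := fun _ : ℂ => (1 : ℂ)) analyticAt_const hk
  rw [one_pow, mul_one, hP.leadingCoeff] at hU0
  have hvan : AnalyticAt ℂ (fun s => U₀ s - 1) 0 := hUan.sub analyticAt_const
  have hv0 : U₀ 0 - 1 = 0 := by rw [hU0, sub_self]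
  have hqk' : ∀ᶠ s in 𝓝 (0 : ℂ), q (U₀ s - 1) ^ k = 1 + (U₀ s - 1) := by
    have h := hvan.continuousAt.tendsto
    rw [hv0] at h
    exact h.eventually hqk
  refine ⟨fun s => ζ * q (U₀ s - 1), analyticAt_const.mul (hqan.comp_of_eq hvan hv0),
    by simp only [hU0, sub_self, hq0, mul_one], ?_, ?_⟩
  · -- flatness: `‖q(v) − 1‖ ≤ C‖v‖` near `0` and `‖U₀(s) − 1‖ ≤ C'‖s‖^k` near `0`
    obtain ⟨C₁, hC₁⟩ := (hqan.differentiableAt.hasDerivAt.isBigO_sub).bound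
    simp only [sub_zero, hq0] at hC₁
    set C : ℝ := max C₁ 0 with hCdef
    have hC0 : 0 ≤ C := le_max_right _ _
    have hC : ∀ᶠ v in 𝓝 (0 : ℂ), ‖q v - 1‖ ≤ C * ‖v‖ := hC₁.mono fun v hv =>
      hv.trans (mul_le_mul_of_nonneg_right (le_max_left _ _) (norm_nonneg _))
    have hvt : Tendsto (fun s => (U₀ s - 1) / s ^ k) (𝓝[≠] (0 : ℂ)) (𝓝 (P.coeff (M - 1))) := by
      refine (tendsto_monic_polar_sub_one_div_pow hP hMdef.symm hM hk).congr' ?_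
      filter_upwards [self_mem_nhdsWithin] with s (hs : s ≠ 0)
      have hU := hUeval s hs
      simp only [one_mul, inv_pow] at hU
      rw [inv_pow, hU, ← hMdef, mul_assoc, inv_mul_cancel₀ (pow_ne_zero _ hs), mul_one]
    have hvbd : ∀ᶠ s in 𝓝 (0 : ℂ), ‖U₀ s - 1‖ ≤ (‖P.coeff (M - 1)‖ + 1) * ‖s‖ ^ k := by
      have h1 : ∀ᶠ s in 𝓝[≠] (0 : ℂ), ‖(U₀ s - 1) / s ^ k‖ < ‖P.coeff (M - 1)‖ + 1 := by
        have h := (continuous_norm.tendsto _).comp hvt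
        exact (tendsto_order.1 h).2 _ (by simp)
      have h2 : ∀ᶠ s in 𝓝[≠] (0 : ℂ), ‖U₀ s - 1‖ ≤ (‖P.coeff (M - 1)‖ + 1) * ‖s‖ ^ k := by
        filter_upwards [h1, self_mem_nhdsWithin] with s hs (hs0 : s ≠ 0)
        have hsk : 0 < ‖s‖ ^ k := pow_pos (norm_pos_iff.2 hs0) _
        rw [norm_div, norm_pow, div_lt_iff₀ hsk] at hs
        exact hs.le
      refine (eventually_nhdsWithin_iff.1 h2).mono fun s hs => ?_
      by_cases hs0 : s = 0
      · rw [hs0, hU0, sub_self, norm_zero]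
        positivity
      · exact hs hs0
    refine ⟨‖ζ‖ * C * (‖P.coeff (M - 1)‖ + 1), ?_⟩
    have hvt0 : Tendsto (fun s => U₀ s - 1) (𝓝 (0 : ℂ)) (𝓝 0) := by
      have h := hvan.continuousAt.tendsto
      rwa [hv0] at h
    filter_upwards [hvbd, hvt0.eventually hC] with s hs1 hs2
    simp only [hU0, sub_self, hq0, mul_one]
    rw [show ζ * q (U₀ s - 1) - ζ = ζ * (q (U₀ s - 1) - 1) by ring, norm_mul]
    calc ‖ζ‖ * ‖q (U₀ s - 1) - 1‖ ≤ ‖ζ‖ * (C * ‖U₀ s - 1‖) :=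
          mul_le_mul_of_nonneg_left hs2 (norm_nonneg _)
      _ ≤ ‖ζ‖ * (C * ((‖P.coeff (M - 1)‖ + 1) * ‖s‖ ^ k)) :=
          mul_le_mul_of_nonneg_left (mul_le_mul_of_nonneg_left hs1 hC0) (norm_nonneg _)
      _ = ‖ζ‖ * C * (‖P.coeff (M - 1)‖ + 1) * ‖s‖ ^ k := by ring
  · filter_upwards [self_mem_nhdsWithin, nhdsWithin_le_nhds hqk'] with s (hs : s ≠ 0) hqs
    have hU := hUeval s hs
    simp only [one_mul, inv_pow] at hU
    rw [mul_pow, mul_pow, hζ, one_mul, hqs, hU, inv_pow, ← pow_mul, Nat.mul_comm M k,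
      show (1 : ℂ) + (U₀ s - 1) = U₀ s by ring, sub_self]

/-! ## Part B. The coordinate fibres over `x₁^k = P(x₀)`, `deg P > k`: no residue class -/

/-- **`y₀ = x₁` over `x₁^k = P(x₀)`, `1 ≤ k < deg P`: dense** (`P` monic with a simple root) — NO
residue condition (flat sheet + logarithmic term). [cite: MantovaMasser2023, §1 Further remarks,
p. 5 (the question, open in general)] (new) -/
theorem unprojectedDense_superelliptic_fibre_x₁_of_lt {k : ℕ} (hk : 1 ≤ k) (hP : P.Monic)
    (hkM : k < P.natDegree) {r : ℂ} (hr : P.IsRoot r) (hr1 : P.derivative.eval r ≠ 0) :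
    UnprojectedDense {w : Fin 2 ⊕ Fin 2 → ℂ |
      MvPolynomial.eval ![w (Sum.inl 0), w (Sum.inl 1)]
          (X 1 ^ k - Polynomial.aeval (X 0 : MvPolynomial (Fin 2) ℂ) P) = 0 ∧
      w (Sum.inr 0) = MvPolynomial.eval ![w (Sum.inl 0), w (Sum.inl 1)]
        (X 1 : MvPolynomial (Fin 2) ℂ)} := by
  have hM0 : P.natDegree ≠ 0 := by omega
  have hS := isIrreducibleClosed_curveGraphFibre (X 1 : MvPolynomial (Fin 2) ℂ)
    (irreducible_superellipticMv P hk hr hr1)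
  have hdim := zariskiDim_curveGraphFibre (X 1 : MvPolynomial (Fin 2) ℂ)
    (irreducible_superellipticMv P hk hr hr1)
  obtain ⟨Φ, hΦan, hΦ0, hflat, hsheet⟩ := superelliptic_sheet_facts_flat P hk hP (by omega) (one_pow k)
  have hgerm : ∀ᶠ s in 𝓝[≠] (0 : ℂ),
      (Sum.elim ![(s ^ k)⁻¹, Φ s * (s ^ P.natDegree)⁻¹]
          ![Φ s * s ^ (-(P.natDegree : ℤ)), Complex.exp (Φ s * (s ^ P.natDegree)⁻¹)] :
            Fin 2 ⊕ Fin 2 → ℂ) ∈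
        {w : Fin 2 ⊕ Fin 2 → ℂ |
          MvPolynomial.eval ![w (Sum.inl 0), w (Sum.inl 1)]
              (X 1 ^ k - Polynomial.aeval (X 0 : MvPolynomial (Fin 2) ℂ) P) = 0 ∧
          w (Sum.inr 0) = MvPolynomial.eval ![w (Sum.inl 0), w (Sum.inl 1)]
            (X 1 : MvPolynomial (Fin 2) ℂ)} := by
    filter_upwards [hsheet] with s hs
    refine ⟨?_, ?_⟩
    · simp only [Sum.elim_inl, Matrix.cons_val_zero, Matrix.cons_val_one]
      rw [eval_superellipticMv]
      simpa only [Matrix.cons_val_zero, Matrix.cons_val_one] using hs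
    · simp only [Sum.elim_inr, Sum.elim_inl, Matrix.cons_val_zero, Matrix.cons_val_one,
        MvPolynomial.eval_X, zpow_neg, zpow_natCast]
  refine unprojectedDense_branch_poleFibre_of_flat hS (le_of_eq hdim) hk hkM
    (L := -(P.natDegree : ℤ)) (by simpa using hM0) hΦan (by rw [hΦ0]; exact one_ne_zero) hΦan
    (by rw [hΦ0]; exact one_ne_zero) hflat hgerm

/-- **`y₀ = x₀` over `x₁^k = P(x₀)`, `1 ≤ k < deg P`: dense** (`P` monic with a simple root).
[cite: MantovaMasser2023, §1 Further remarks, p. 5 (the question, open in general)] (new) -/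
theorem unprojectedDense_superelliptic_fibre_x₀_of_lt {k : ℕ} (hk : 1 ≤ k) (hP : P.Monic)
    (hkM : k < P.natDegree) {r : ℂ} (hr : P.IsRoot r) (hr1 : P.derivative.eval r ≠ 0) :
    UnprojectedDense {w : Fin 2 ⊕ Fin 2 → ℂ |
      MvPolynomial.eval ![w (Sum.inl 0), w (Sum.inl 1)]
          (X 1 ^ k - Polynomial.aeval (X 0 : MvPolynomial (Fin 2) ℂ) P) = 0 ∧
      w (Sum.inr 0) = MvPolynomial.eval ![w (Sum.inl 0), w (Sum.inl 1)]
        (X 0 : MvPolynomial (Fin 2) ℂ)} := by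
  have hk0 : k ≠ 0 := by omega
  have hS := isIrreducibleClosed_curveGraphFibre (X 0 : MvPolynomial (Fin 2) ℂ)
    (irreducible_superellipticMv P hk hr hr1)
  have hdim := zariskiDim_curveGraphFibre (X 0 : MvPolynomial (Fin 2) ℂ)
    (irreducible_superellipticMv P hk hr hr1)
  obtain ⟨Φ, hΦan, hΦ0, hflat, hsheet⟩ := superelliptic_sheet_facts_flat P hk hP (by omega) (one_pow k)
  have hgerm : ∀ᶠ s in 𝓝[≠] (0 : ℂ),
      (Sum.elim ![(s ^ k)⁻¹, Φ s * (s ^ P.natDegree)⁻¹]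
          ![(fun _ : ℂ => (1 : ℂ)) s * s ^ (-(k : ℤ)), Complex.exp (Φ s * (s ^ P.natDegree)⁻¹)] :
            Fin 2 ⊕ Fin 2 → ℂ) ∈
        {w : Fin 2 ⊕ Fin 2 → ℂ |
          MvPolynomial.eval ![w (Sum.inl 0), w (Sum.inl 1)]
              (X 1 ^ k - Polynomial.aeval (X 0 : MvPolynomial (Fin 2) ℂ) P) = 0 ∧
          w (Sum.inr 0) = MvPolynomial.eval ![w (Sum.inl 0), w (Sum.inl 1)]
            (X 0 : MvPolynomial (Fin 2) ℂ)} := by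
    filter_upwards [hsheet] with s hs
    refine ⟨?_, ?_⟩
    · simp only [Sum.elim_inl, Matrix.cons_val_zero, Matrix.cons_val_one]
      rw [eval_superellipticMv]
      simpa only [Matrix.cons_val_zero, Matrix.cons_val_one] using hs
    · simp only [Sum.elim_inr, Sum.elim_inl, Matrix.cons_val_zero, MvPolynomial.eval_X, zpow_neg,
        zpow_natCast, one_mul]
  refine unprojectedDense_branch_poleFibre_of_flat hS (le_of_eq hdim) hk hkM (L := -(k : ℤ))
    (by simpa using hk0) analyticAt_const one_ne_zero hΦan (by rw [hΦ0]; exact one_ne_zero) hflat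
    hgerm

/-- **Mantova–Masser's question for the coordinate fibres over `x₁^k = P(x₀)`, ALL `2 ≤ k < deg P`:
case ∧ dense** (`P` monic with a simple root), both fibres, in plain coordinates — no residue class.
[cite: MantovaMasser2023, §1 Further remarks, p. 5 (the question, open in general)] (new) -/
theorem unprojectedDensityQuestion_superelliptic_coordFibres {k : ℕ} (hk : 2 ≤ k) (hP : P.Monic)
    (hkM : k < P.natDegree) {r : ℂ} (hr : P.IsRoot r) (hr1 : P.derivative.eval r ≠ 0) :
    (MMCaseDimPiOneFree {w : Fin 2 ⊕ Fin 2 → ℂ |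
        w (Sum.inl 1) ^ k - P.eval (w (Sum.inl 0)) = 0 ∧ w (Sum.inr 0) = w (Sum.inl 1)} ∧
      UnprojectedDense {w : Fin 2 ⊕ Fin 2 → ℂ |
        w (Sum.inl 1) ^ k - P.eval (w (Sum.inl 0)) = 0 ∧ w (Sum.inr 0) = w (Sum.inl 1)}) ∧
    (MMCaseDimPiOneFree {w : Fin 2 ⊕ Fin 2 → ℂ |
        w (Sum.inl 1) ^ k - P.eval (w (Sum.inl 0)) = 0 ∧ w (Sum.inr 0) = w (Sum.inl 0)} ∧
      UnprojectedDense {w : Fin 2 ⊕ Fin 2 → ℂ |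
        w (Sum.inl 1) ^ k - P.eval (w (Sum.inl 0)) = 0 ∧ w (Sum.inr 0) = w (Sum.inl 0)}) := by
  have hP0 : P ≠ 0 := by
    rintro rfl
    simp at hr1
  have e₁ : {w : Fin 2 ⊕ Fin 2 → ℂ |
        MvPolynomial.eval ![w (Sum.inl 0), w (Sum.inl 1)]
            (X 1 ^ k - Polynomial.aeval (X 0 : MvPolynomial (Fin 2) ℂ) P) = 0 ∧
        w (Sum.inr 0) = MvPolynomial.eval ![w (Sum.inl 0), w (Sum.inl 1)]
          (X 1 : MvPolynomial (Fin 2) ℂ)} =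
      {w : Fin 2 ⊕ Fin 2 → ℂ |
        w (Sum.inl 1) ^ k - P.eval (w (Sum.inl 0)) = 0 ∧ w (Sum.inr 0) = w (Sum.inl 1)} := by
    ext w
    simp only [Set.mem_setOf_eq, eval_superellipticMv, MvPolynomial.eval_X, Matrix.cons_val_zero,
      Matrix.cons_val_one]
  have e₀ : {w : Fin 2 ⊕ Fin 2 → ℂ |
        MvPolynomial.eval ![w (Sum.inl 0), w (Sum.inl 1)]
            (X 1 ^ k - Polynomial.aeval (X 0 : MvPolynomial (Fin 2) ℂ) P) = 0 ∧
        w (Sum.inr 0) = MvPolynomial.eval ![w (Sum.inl 0), w (Sum.inl 1)]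
          (X 0 : MvPolynomial (Fin 2) ℂ)} =
      {w : Fin 2 ⊕ Fin 2 → ℂ |
        w (Sum.inl 1) ^ k - P.eval (w (Sum.inl 0)) = 0 ∧ w (Sum.inr 0) = w (Sum.inl 0)} := by
    ext w
    simp only [Set.mem_setOf_eq, eval_superellipticMv, MvPolynomial.eval_X, Matrix.cons_val_zero,
      Matrix.cons_val_one]
  have hcase₀ : MMCaseDimPiOneFree {w : Fin 2 ⊕ Fin 2 → ℂ |
      MvPolynomial.eval ![w (Sum.inl 0), w (Sum.inl 1)]
          (X 1 ^ k - Polynomial.aeval (X 0 : MvPolynomial (Fin 2) ℂ) P) = 0 ∧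
      w (Sum.inr 0) = MvPolynomial.eval ![w (Sum.inl 0), w (Sum.inl 1)]
        (X 0 : MvPolynomial (Fin 2) ℂ)} := by
    refine mmCase_curveGraphFibre (irreducible_superellipticMv P (by omega) hr hr1) ?_
      (superelliptic_not_on_line P hk hP0)
    obtain ⟨x, hx, hx0, -⟩ := superelliptic_exists_point_ne_zero P (k := k) (by omega) hP0
    exact ⟨x, hx, by rw [MvPolynomial.eval_X]; exact hx0⟩
  have h₁ : MMCaseDimPiOneFree _ ∧ UnprojectedDense _ :=
    ⟨mmCase_superelliptic_fibre_x₁ P (k := k) hk hr hr1,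
      unprojectedDense_superelliptic_fibre_x₁_of_lt P (by omega) hP hkM hr hr1⟩
  have h₀ : MMCaseDimPiOneFree _ ∧ UnprojectedDense _ :=
    ⟨hcase₀, unprojectedDense_superelliptic_fibre_x₀_of_lt P (by omega) hP hkM hr hr1⟩
  rw [e₁] at h₁
  rw [e₀] at h₀
  exact ⟨h₁, h₀⟩

/-- **EVERY hyperelliptic curve of degree `≥ 3`**: for `P` monic of degree `≥ 3` with a simple root,
`{x₁² − P(x₀) = 0, y₀ = x₁}` and `{x₁² − P(x₀) = 0, y₀ = x₀}` are in Mantova–Masser's case AND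
dense (every genus; the degrees `≡ 2 (mod 4)` — genus `2, 4, …` — are new).
[cite: MantovaMasser2023, §1 Further remarks, p. 5 (the question, open in general)] (new) -/
theorem unprojectedDensityQuestion_hyperelliptic_coordFibres (hP : P.Monic) (h3 : 3 ≤ P.natDegree)
    {r : ℂ} (hr : P.IsRoot r) (hr1 : P.derivative.eval r ≠ 0) :
    (MMCaseDimPiOneFree {w : Fin 2 ⊕ Fin 2 → ℂ |
        w (Sum.inl 1) ^ 2 - P.eval (w (Sum.inl 0)) = 0 ∧ w (Sum.inr 0) = w (Sum.inl 1)} ∧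
      UnprojectedDense {w : Fin 2 ⊕ Fin 2 → ℂ |
        w (Sum.inl 1) ^ 2 - P.eval (w (Sum.inl 0)) = 0 ∧ w (Sum.inr 0) = w (Sum.inl 1)}) ∧
    (MMCaseDimPiOneFree {w : Fin 2 ⊕ Fin 2 → ℂ |
        w (Sum.inl 1) ^ 2 - P.eval (w (Sum.inl 0)) = 0 ∧ w (Sum.inr 0) = w (Sum.inl 0)} ∧
      UnprojectedDense {w : Fin 2 ⊕ Fin 2 → ℂ |
        w (Sum.inl 1) ^ 2 - P.eval (w (Sum.inl 0)) = 0 ∧ w (Sum.inr 0) = w (Sum.inl 0)}) :=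
  unprojectedDensityQuestion_superelliptic_coordFibres P (le_refl 2) hP (by omega) hr hr1

end Superelliptic

end Summit.Schanuel.Schanuel.Theorems

end
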